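import Summits.CriticalPhenomena.PercolationContinuityZ3.Theorems.PercNearOneGluingNoHeavyLowerTailSahiCombTriWAndClawPlusTwo

/-!
# AND with a claw with TWO doubled prongs, all `k ≥ 8`: `clawPlusTwo p₁ q₁ p₂ q₂ = claw k ∪ {⊤∖{p₁,q₁}, ⊤∖{p₂,q₂}}`

Support file of the one-cut programme (crux `NoHeavyLowerTail`, stmt-CriticalPhenomena-4575; unit `prim-lf-1` gen 49), continuation of
`…SahiCombTriWAndClaw` (main lemma), `…AndClawPlus` (one doubled prong), `…AndClawPlusTwo` (the family and the case `k = 5` = `cocover5`).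

* **`corP_andProd_clawPlusTwo_nonneg_of_eight_le`** (`k ≥ 8`, two disjoint pairs): `Cor_{P₁ ∧ clawPlusTwo p₁ q₁ p₂ q₂}(A,B) ≥ 0` for every antipode-free
  up-set `P₁` with `Cor_{P₁} ≥ 0` and all up-sets `A, B` of `2^{γ₁ ⊕ Fin k}` — the block is `claw_{k-2}` with TWO prongs doubled
  (`maj/claw ∘ (x_{p₁}x_{q₁}, x_{p₂}x_{q₂}, x_r, …)`, generated by the `k − 2` pairwise co-covering sets `⊤∖{p₁,q₁}, ⊤∖{p₂,q₂}, ⊤∖{r}`);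
  `triW_nonneg_andProd_clawPlusTwo_of_eight_le`, `klShell_…`, `lForm_le_scoreVal_…` (the typed conjecture `AndShellLower` for these blocks).
* ONE certificate for every `k ≥ 8` (`clawPlusTwo_cert_identity_gen`, exact symbol-cone LP; memo `FROM-prim-lf-1-gen49-CLAW.md` §3).  Sorted co-atom columns
  `a=s₀ ≤ b=s₁ ≤ g=s₂ ≤ h=s₃ ≤ (inner) ≤ e=s_{k-4} ≤ f=s_{k-3} ≤ c=s_{k-2} ≤ d=s_{k-1} ≤ u`, extra columns sorted `m ≤ M` (`m ≤ e`, `M ≤ c`):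
  `2(uu' + ad' + bc' + gf' + he' + eh' + fg' + cb' + da' + mM' + Mm') = sym(u,a+b) + sym(d,a+b) + sym(g,f) + sym(h,e) + sym(h,f) + sym(c,m+g) + sym(m+e,M) + NN`
  (`sym(x,y) = xy' + yx'`), i.e. the claw row affords the slack `½[c(g'+e') + (g+e)c']`, which the two extra columns consume.  The inner products
  `s_j s'_{k-1-j}` (`4 ≤ j ≤ k-5`) are `unit ⊗ unit`.  The cases `k = 6, 7` (where `g,h` and `e,f` collide) have their own LP certificates and are NOT here;
  `k = 5` is `…AndClawPlusTwo`.
HONEST LABEL: complete proofs, std axioms; no new definitions; an infinite stratum of `TriWIneq`; the AND-substituted-claw conjecture stays OPEN. [this work]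
-/

namespace Summit.CriticalPhenomena.PercolationContinuityZ3.Theorems

namespace FiveUpSet

open Finset

variable {γ₁ : Type} [DecidableEq γ₁] [Fintype γ₁] {k : ℕ}

/-- The polynomial identity behind the general two-prong certificate. [this work] -/
theorem clawPlusTwo_cert_identity_gen (u a b g h e f c d m M u' a' b' g' h' e' f' c' d' m' M' : ℤ) :
    2 * (u * u' + a * d' + b * c' + g * f' + h * e' + e * h' + f * g' + c * b' + d * a' + m * M' + M * m')
      = (u * (a' + b') + (a + b) * u' + d * (a' + b') + (a + b) * d' + (g * f' + f * g') + (h * e' + e * h') + (h * f' + f * h')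
          + (c * (m' + g') + (m + g) * c') + ((m + e) * M' + M * (m' + e')))
        + ((b - a) * (u' - d') + (u - d) * (b' - a') + 2 * ((c - b) * (d' - c') + (d - c) * (c' - b'))
          + 2 * ((c - b) * (u' - d') + (u - d) * (c' - b')) + 2 * ((d - c) * (d' - c'))
          + 2 * ((d - c) * (u' - d') + (u - d) * (d' - c')) + 2 * ((u - d) * (u' - d'))
          + (c - h) * (c' - f') + (c - f) * (c' - h') + (c - h) * (f' - e') + (f - e) * (c' - h') + (h - g) * (c' - f') + (c - f) * (h' - g')
          + (c - M) * (e' - m') + (e - m) * (c' - M')) := by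
  ring

section mainthm
variable {P₁ : Finset (Finset γ₁)} (hP : IsUpperSet (P₁ : Set (Finset γ₁))) (hd : Disjoint P₁ (refl P₁))
  (hcor : ∀ U V : Finset (Finset γ₁), IsUpperSet (U : Set (Finset γ₁)) → IsUpperSet (V : Set (Finset γ₁)) → 0 ≤ corP P₁ U V)
  {A B : Finset (Finset (γ₁ ⊕ Fin k))} (hA : IsUpperSet (A : Set (Finset (γ₁ ⊕ Fin k)))) (hB : IsUpperSet (B : Set (Finset (γ₁ ⊕ Fin k))))
  {p₁ q₁ p₂ q₂ : Fin k} (hpq : p₁ ≠ q₁ ∧ p₂ ≠ q₂ ∧ p₁ ≠ p₂ ∧ p₁ ≠ q₂ ∧ q₁ ≠ p₂ ∧ q₁ ≠ q₂)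

include hA hB hpq in
/-- **Pointwise certificate**: the `K ⊗ K` part is at most twice the extreme part of the rearranged row. [this work] -/
theorem clawPlusTwo_cert_gen {j0 j1 j2 j3 je jf jc jd : Fin k} (h01 : j0 ≤ j1) (h12 : j1 ≤ j2) (h23 : j2 ≤ j3) (h3f : j3 ≤ jf)
    (hef : je ≤ jf) (hfc : jf ≤ jc) (hcd : jc ≤ jd) (hje : (je : ℕ) = k - 4) (hjc : (jc : ℕ) = k - 2) (x : Finset γ₁) :
    clawU A x * (clawS B x j0 + clawS B x j1) + (clawS A x j0 + clawS A x j1) * clawU B x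
      + clawS A x jd * (clawS B x j0 + clawS B x j1) + (clawS A x j0 + clawS A x j1) * clawS B x jd
      + (clawS A x j2 * clawS B x jf + clawS A x jf * clawS B x j2) + (clawS A x j3 * clawS B x je + clawS A x je * clawS B x j3)
      + (clawS A x j3 * clawS B x jf + clawS A x jf * clawS B x j3)
      + (clawS A x jc * (clawVmin B p₁ q₁ p₂ q₂ x + clawS B x j2) + (clawVmin A p₁ q₁ p₂ q₂ x + clawS A x j2) * clawS B x jc)
      + ((clawVmin A p₁ q₁ p₂ q₂ x + clawS A x je) * clawVmax B p₁ q₁ p₂ q₂ x + clawVmax A p₁ q₁ p₂ q₂ x * (clawVmin B p₁ q₁ p₂ q₂ x + clawS B x je))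
    ≤ 2 * (clawU A x * clawU B x + clawS A x j0 * clawS B x jd + clawS A x j1 * clawS B x jc + clawS A x j2 * clawS B x jf
      + clawS A x j3 * clawS B x je + clawS A x je * clawS B x j3 + clawS A x jf * clawS B x j2 + clawS A x jc * clawS B x j1
      + clawS A x jd * clawS B x j0
      + clawVmin A p₁ q₁ p₂ q₂ x * clawVmax B p₁ q₁ p₂ q₂ x + clawVmax A p₁ q₁ p₂ q₂ x * clawVmin B p₁ q₁ p₂ q₂ x) := by
  have hid := clawPlusTwo_cert_identity_gen (clawU A x) (clawS A x j0) (clawS A x j1) (clawS A x j2) (clawS A x j3) (clawS A x je)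
    (clawS A x jf) (clawS A x jc) (clawS A x jd) (clawVmin A p₁ q₁ p₂ q₂ x) (clawVmax A p₁ q₁ p₂ q₂ x)
    (clawU B x) (clawS B x j0) (clawS B x j1) (clawS B x j2) (clawS B x j3) (clawS B x je)
    (clawS B x jf) (clawS B x jc) (clawS B x jd) (clawVmin B p₁ q₁ p₂ q₂ x) (clawVmax B p₁ q₁ p₂ q₂ x)
  have h3c : j3 ≤ jc := h3f.trans hfc
  have a10 : 0 ≤ clawS A x j1 - clawS A x j0 := sub_nonneg.2 (clawS_monotone A x h01)
  have ac1 : 0 ≤ clawS A x jc - clawS A x j1 := sub_nonneg.2 (clawS_monotone A x (h12.trans (h23.trans h3c)))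
  have adc : 0 ≤ clawS A x jd - clawS A x jc := sub_nonneg.2 (clawS_monotone A x hcd)
  have aud : 0 ≤ clawU A x - clawS A x jd := sub_nonneg.2 (clawS_le_clawU hA x jd)
  have ach : 0 ≤ clawS A x jc - clawS A x j3 := sub_nonneg.2 (clawS_monotone A x h3c)
  have acf : 0 ≤ clawS A x jc - clawS A x jf := sub_nonneg.2 (clawS_monotone A x hfc)
  have afe : 0 ≤ clawS A x jf - clawS A x je := sub_nonneg.2 (clawS_monotone A x hef)
  have ahg : 0 ≤ clawS A x j3 - clawS A x j2 := sub_nonneg.2 (clawS_monotone A x h23)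
  have acM : 0 ≤ clawS A x jc - clawVmax A p₁ q₁ p₂ q₂ x := sub_nonneg.2 (clawVmax_le_clawS hA hpq x jc hjc)
  have aem : 0 ≤ clawS A x je - clawVmin A p₁ q₁ p₂ q₂ x := sub_nonneg.2 (clawVmin_le_clawS hA hpq x je hje)
  have b10 : 0 ≤ clawS B x j1 - clawS B x j0 := sub_nonneg.2 (clawS_monotone B x h01)
  have bc1 : 0 ≤ clawS B x jc - clawS B x j1 := sub_nonneg.2 (clawS_monotone B x (h12.trans (h23.trans h3c)))
  have bdc : 0 ≤ clawS B x jd - clawS B x jc := sub_nonneg.2 (clawS_monotone B x hcd)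
  have bud : 0 ≤ clawU B x - clawS B x jd := sub_nonneg.2 (clawS_le_clawU hB x jd)
  have bch : 0 ≤ clawS B x jc - clawS B x j3 := sub_nonneg.2 (clawS_monotone B x h3c)
  have bcf : 0 ≤ clawS B x jc - clawS B x jf := sub_nonneg.2 (clawS_monotone B x hfc)
  have bfe : 0 ≤ clawS B x jf - clawS B x je := sub_nonneg.2 (clawS_monotone B x hef)
  have bhg : 0 ≤ clawS B x j3 - clawS B x j2 := sub_nonneg.2 (clawS_monotone B x h23)
  have bcM : 0 ≤ clawS B x jc - clawVmax B p₁ q₁ p₂ q₂ x := sub_nonneg.2 (clawVmax_le_clawS hB hpq x jc hjc)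
  have bem : 0 ≤ clawS B x je - clawVmin B p₁ q₁ p₂ q₂ x := sub_nonneg.2 (clawVmin_le_clawS hB hpq x je hje)
  have n1 := mul_nonneg a10 bud; have n2 := mul_nonneg aud b10; have n3 := mul_nonneg ac1 bdc; have n4 := mul_nonneg adc bc1
  have n5 := mul_nonneg ac1 bud; have n6 := mul_nonneg aud bc1; have n7 := mul_nonneg adc bdc; have n8 := mul_nonneg adc bud
  have n9 := mul_nonneg aud bdc; have n10 := mul_nonneg aud bud
  have n11 := mul_nonneg ach bcf; have n12 := mul_nonneg acf bch; have n13 := mul_nonneg ach bfe; have n14 := mul_nonneg afe bch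
  have n15 := mul_nonneg ahg bcf; have n16 := mul_nonneg acf bhg; have n17 := mul_nonneg acM bem; have n18 := mul_nonneg aem bcM
  linarith

include hP hd hcor hA hB hpq in
/-- **Acuteness of the `K ⊗ K` part** (seven symmetric pairs of unit / two-layer `K`-vectors), `k ≥ 6` through the index hypotheses. [this work] -/
theorem clawPlusTwo_KK_sum_nonneg_gen {j0 j1 j2 j3 je jf jc jd : Fin k} (hj1 : 1 ≤ (j1 : ℕ)) (hj2 : 2 ≤ (j2 : ℕ)) (hj3 : 1 ≤ (j3 : ℕ))
    (hje : 2 ≤ (je : ℕ)) (hjf : 1 ≤ (jf : ℕ)) (hjc : 1 ≤ (jc : ℕ)) (hjd : 1 ≤ (jd : ℕ)) :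
    0 ≤ ∑ x ∈ P₁, (clawU A x * (clawS B x j0 + clawS B x j1) + (clawS A x j0 + clawS A x j1) * clawU B x
      + clawS A x jd * (clawS B x j0 + clawS B x j1) + (clawS A x j0 + clawS A x j1) * clawS B x jd
      + (clawS A x j2 * clawS B x jf + clawS A x jf * clawS B x j2) + (clawS A x j3 * clawS B x je + clawS A x je * clawS B x j3)
      + (clawS A x j3 * clawS B x jf + clawS A x jf * clawS B x j3)
      + (clawS A x jc * (clawVmin B p₁ q₁ p₂ q₂ x + clawS B x j2) + (clawVmin A p₁ q₁ p₂ q₂ x + clawS A x j2) * clawS B x jc)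
      + ((clawVmin A p₁ q₁ p₂ q₂ x + clawS A x je) * clawVmax B p₁ q₁ p₂ q₂ x
        + clawVmax A p₁ q₁ p₂ q₂ x * (clawVmin B p₁ q₁ p₂ q₂ x + clawS B x je))) := by
  simp only [sum_add_distrib]
  -- bounds
  have bS2 : ∀ (C : Finset (Finset (γ₁ ⊕ Fin k))) (i j : Fin k), ∀ x ∈ P₁, -2 ≤ clawS C x i + clawS C x j ∧ clawS C x i + clawS C x j ≤ 2 :=
    fun C i j x _ => by have := clawS_bounds C x i; have := clawS_bounds C x j; constructor <;> linarith
  have bS1 : ∀ (C : Finset (Finset (γ₁ ⊕ Fin k))) (j : Fin k), ∀ x ∈ P₁, -2 ≤ clawS C x j ∧ clawS C x j ≤ 2 :=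
    fun C j x _ => by have := clawS_bounds C x j; constructor <;> linarith
  have bU : ∀ (C : Finset (Finset (γ₁ ⊕ Fin k))), ∀ x ∈ P₁, -2 ≤ clawU C x ∧ clawU C x ≤ 2 :=
    fun C x _ => by have := clawU_bounds (A := C) x; constructor <;> linarith
  have bmS : ∀ (C : Finset (Finset (γ₁ ⊕ Fin k))) (j : Fin k), ∀ x ∈ P₁,
      -2 ≤ clawVmin C p₁ q₁ p₂ q₂ x + clawS C x j ∧ clawVmin C p₁ q₁ p₂ q₂ x + clawS C x j ≤ 2 :=
    fun C j x _ => by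
      have := clawVmin_bounds (A := C) (p₁ := p₁) (q₁ := q₁) (p₂ := p₂) (q₂ := q₂) x; have := clawS_bounds C x j; constructor <;> linarith
  have bM : ∀ (C : Finset (Finset (γ₁ ⊕ Fin k))), ∀ x ∈ P₁, -2 ≤ clawVmax C p₁ q₁ p₂ q₂ x ∧ clawVmax C p₁ q₁ p₂ q₂ x ≤ 2 :=
    fun C x _ => by have := clawVmax_bounds (A := C) (p₁ := p₁) (q₁ := q₁) (p₂ := p₂) (q₂ := q₂) x; constructor <;> linarith
  -- unit ⊗ unit products of sorted columns
  have uu : ∀ i j : Fin k, 1 ≤ (i : ℕ) → 1 ≤ (j : ℕ) → 0 ≤ ∑ x ∈ P₁, clawS A x i * clawS B x j := fun i j hi hj =>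
    sum_mul_nonneg_of_unit hP hd hcor (fun x => clawS A x i) (fun x => clawS B x j)
      (fun x _ => clawS_val A x i) (fun x _ => clawS_val B x j)
      (fun x _ x' _ h => clawS_mono hA h i) (fun x _ x' _ h => clawS_mono hB h j)
      (fun x _ x' _ h => clawS_pair_self hA h i hi) (fun x _ x' _ h => clawS_pair_self hB h j hj)
  have t1 := sum_mul_nonneg_of_two hP hd hcor (fun x => clawU A x) (fun x => clawS B x j0 + clawS B x j1) (bU A) (bS2 B j0 j1)
    (fun x _ x' _ h => clawU_mono hA h) (fun x _ x' _ h => add_le_add (clawS_mono hB h j0) (clawS_mono hB h j1))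
    (fun x _ x' _ h => clawU_add_clawU_nonneg hA h) (fun x _ x' _ h => clawS_add_pair hB h j0 j1 hj1)
  have t2 := sum_mul_nonneg_of_two hP hd hcor (fun x => clawS A x j0 + clawS A x j1) (fun x => clawU B x) (bS2 A j0 j1) (bU B)
    (fun x _ x' _ h => add_le_add (clawS_mono hA h j0) (clawS_mono hA h j1)) (fun x _ x' _ h => clawU_mono hB h)
    (fun x _ x' _ h => clawS_add_pair hA h j0 j1 hj1) (fun x _ x' _ h => clawU_add_clawU_nonneg hB h)
  have t3 := sum_mul_nonneg_of_two hP hd hcor (fun x => clawS A x jd) (fun x => clawS B x j0 + clawS B x j1) (bS1 A jd) (bS2 B j0 j1)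
    (fun x _ x' _ h => clawS_mono hA h jd) (fun x _ x' _ h => add_le_add (clawS_mono hB h j0) (clawS_mono hB h j1))
    (fun x _ x' _ h => clawS_pair_self hA h jd hjd) (fun x _ x' _ h => clawS_add_pair hB h j0 j1 hj1)
  have t4 := sum_mul_nonneg_of_two hP hd hcor (fun x => clawS A x j0 + clawS A x j1) (fun x => clawS B x jd) (bS2 A j0 j1) (bS1 B jd)
    (fun x _ x' _ h => add_le_add (clawS_mono hA h j0) (clawS_mono hA h j1)) (fun x _ x' _ h => clawS_mono hB h jd)
    (fun x _ x' _ h => clawS_add_pair hA h j0 j1 hj1) (fun x _ x' _ h => clawS_pair_self hB h jd hjd)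
  have hj2' : 1 ≤ (j2 : ℕ) := by omega
  have hje' : 1 ≤ (je : ℕ) := by omega
  have t5 := uu j2 jf hj2' hjf; have t6 := uu jf j2 hjf hj2'; have t7 := uu j3 je hj3 hje'; have t8 := uu je j3 hje' hj3
  have t9 := uu j3 jf hj3 hjf; have t10 := uu jf j3 hjf hj3
  have t11 := sum_mul_nonneg_of_two hP hd hcor (fun x => clawS A x jc) (fun x => clawVmin B p₁ q₁ p₂ q₂ x + clawS B x j2) (bS1 A jc) (bmS B j2)
    (fun x _ x' _ h => clawS_mono hA h jc) (fun x _ x' _ h => add_le_add (clawVmin_mono hB h) (clawS_mono hB h j2))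
    (fun x _ x' _ h => clawS_pair_self hA h jc hjc) (fun x _ x' _ h => clawVmin_add_clawS_pair hB (p₁ := p₁) (q₁ := q₁) (p₂ := p₂) (q₂ := q₂) h j2 hj2)
  have t12 := sum_mul_nonneg_of_two hP hd hcor (fun x => clawVmin A p₁ q₁ p₂ q₂ x + clawS A x j2) (fun x => clawS B x jc) (bmS A j2) (bS1 B jc)
    (fun x _ x' _ h => add_le_add (clawVmin_mono hA h) (clawS_mono hA h j2)) (fun x _ x' _ h => clawS_mono hB h jc)
    (fun x _ x' _ h => clawVmin_add_clawS_pair hA (p₁ := p₁) (q₁ := q₁) (p₂ := p₂) (q₂ := q₂) h j2 hj2) (fun x _ x' _ h => clawS_pair_self hB h jc hjc)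
  have t13 := sum_mul_nonneg_of_two hP hd hcor (fun x => clawVmin A p₁ q₁ p₂ q₂ x + clawS A x je) (fun x => clawVmax B p₁ q₁ p₂ q₂ x) (bmS A je) (bM B)
    (fun x _ x' _ h => add_le_add (clawVmin_mono hA h) (clawS_mono hA h je)) (fun x _ x' _ h => clawVmax_mono hB h)
    (fun x _ x' _ h => clawVmin_add_clawS_pair hA (p₁ := p₁) (q₁ := q₁) (p₂ := p₂) (q₂ := q₂) h je hje) (fun x _ x' _ h => clawVmax_pair hB hpq h)
  have t14 := sum_mul_nonneg_of_two hP hd hcor (fun x => clawVmax A p₁ q₁ p₂ q₂ x) (fun x => clawVmin B p₁ q₁ p₂ q₂ x + clawS B x je) (bM A) (bmS B je)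
    (fun x _ x' _ h => clawVmax_mono hA h) (fun x _ x' _ h => add_le_add (clawVmin_mono hB h) (clawS_mono hB h je))
    (fun x _ x' _ h => clawVmax_pair hA hpq h) (fun x _ x' _ h => clawVmin_add_clawS_pair hB (p₁ := p₁) (q₁ := q₁) (p₂ := p₂) (q₂ := q₂) h je hje)
  linarith

include hP hd hcor hA hB hpq in
/-- **THEOREM (AND with a claw with two doubled prongs, `k ≥ 8`).** [this work] -/
theorem corP_andProd_clawPlusTwo_nonneg_of_eight_le (hk : 8 ≤ k) : 0 ≤ corP (andProd P₁ (clawPlusTwo p₁ q₁ p₂ q₂)) A B := by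
  obtain ⟨j0, hj0⟩ : ∃ j : Fin k, (j : ℕ) = 0 := ⟨⟨0, by omega⟩, rfl⟩
  obtain ⟨j1, hj1⟩ : ∃ j : Fin k, (j : ℕ) = 1 := ⟨⟨1, by omega⟩, rfl⟩
  obtain ⟨j2, hj2⟩ : ∃ j : Fin k, (j : ℕ) = 2 := ⟨⟨2, by omega⟩, rfl⟩
  obtain ⟨j3, hj3⟩ : ∃ j : Fin k, (j : ℕ) = 3 := ⟨⟨3, by omega⟩, rfl⟩
  obtain ⟨je, hje⟩ : ∃ j : Fin k, (j : ℕ) = k - 4 := ⟨⟨k - 4, by omega⟩, rfl⟩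
  obtain ⟨jf, hjf⟩ : ∃ j : Fin k, (j : ℕ) = k - 3 := ⟨⟨k - 3, by omega⟩, rfl⟩
  obtain ⟨jc, hjc⟩ : ∃ j : Fin k, (j : ℕ) = k - 2 := ⟨⟨k - 2, by omega⟩, rfl⟩
  obtain ⟨jd, hjd⟩ : ∃ j : Fin k, (j : ℕ) = k - 1 := ⟨⟨k - 1, by omega⟩, rfl⟩
  have r0 : Fin.rev j0 = jd := Fin.ext (by rw [Fin.val_rev]; omega)
  have r1 : Fin.rev j1 = jc := Fin.ext (by rw [Fin.val_rev]; omega)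
  have r2 : Fin.rev j2 = jf := Fin.ext (by rw [Fin.val_rev]; omega)
  have r3 : Fin.rev j3 = je := Fin.ext (by rw [Fin.val_rev]; omega)
  have re : Fin.rev je = j3 := Fin.ext (by rw [Fin.val_rev]; omega)
  have rf : Fin.rev jf = j2 := Fin.ext (by rw [Fin.val_rev]; omega)
  have rc : Fin.rev jc = j1 := Fin.ext (by rw [Fin.val_rev]; omega)
  have rd : Fin.rev jd = j0 := Fin.ext (by rw [Fin.val_rev]; omega)
  -- the eight extreme indices as a set
  set S8 : Finset (Fin k) := {j0, j1, j2, j3, je, jf, jc, jd} with hS8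
  have ne : ∀ i j : Fin k, (i : ℕ) ≠ (j : ℕ) → i ≠ j := fun i j h e => h (congrArg Fin.val e)
  have hsplit : ∀ F : Fin k → ℤ, ∑ j, F j = (∑ j ∈ univ \ S8, F j) + (F j0 + F j1 + F j2 + F j3 + F je + F jf + F jc + F jd) := by
    intro F
    rw [← sum_sdiff (subset_univ S8), hS8, sum_insert, sum_insert, sum_insert, sum_insert, sum_insert, sum_insert, sum_insert, sum_singleton]
    · ring
    · rw [mem_singleton]; exact ne _ _ (by omega)
    · simp only [mem_insert, mem_singleton, not_or]; exact ⟨ne _ _ (by omega), ne _ _ (by omega)⟩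
    · simp only [mem_insert, mem_singleton, not_or]; exact ⟨ne _ _ (by omega), ne _ _ (by omega), ne _ _ (by omega)⟩
    · simp only [mem_insert, mem_singleton, not_or]; exact ⟨ne _ _ (by omega), ne _ _ (by omega), ne _ _ (by omega), ne _ _ (by omega)⟩
    · simp only [mem_insert, mem_singleton, not_or]
      exact ⟨ne _ _ (by omega), ne _ _ (by omega), ne _ _ (by omega), ne _ _ (by omega), ne _ _ (by omega)⟩
    · simp only [mem_insert, mem_singleton, not_or]
      exact ⟨ne _ _ (by omega), ne _ _ (by omega), ne _ _ (by omega), ne _ _ (by omega), ne _ _ (by omega), ne _ _ (by omega)⟩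
    · simp only [mem_insert, mem_singleton, not_or]
      exact ⟨ne _ _ (by omega), ne _ _ (by omega), ne _ _ (by omega), ne _ _ (by omega), ne _ _ (by omega), ne _ _ (by omega),
        ne _ _ (by omega)⟩
  have hmid : ∀ j ∈ univ \ S8, 1 ≤ (j : ℕ) ∧ 1 ≤ ((Fin.rev j : Fin k) : ℕ) := by
    intro j hj
    rw [mem_sdiff, hS8] at hj
    simp only [mem_insert, mem_singleton, not_or] at hj
    obtain ⟨-, hne0, -, -, -, -, -, -, hned⟩ := hj
    have h0 : (j : ℕ) ≠ 0 := fun h => hne0 (Fin.ext (by omega))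
    have hd' : (j : ℕ) ≠ k - 1 := fun h => hned (Fin.ext (by omega))
    rw [Fin.val_rev]
    have := j.isLt
    omega
  rw [corP_andProd_clawPlusTwo_eq hpq, corP_andProd_claw_eq]
  -- (1) pointwise rearrangements
  have step1 : ∀ x ∈ P₁,
      (clawU A x * clawU B x + clawS A x j0 * clawS B x jd + clawS A x j1 * clawS B x jc + clawS A x j2 * clawS B x jf
        + clawS A x j3 * clawS B x je + clawS A x je * clawS B x j3 + clawS A x jf * clawS B x j2 + clawS A x jc * clawS B x j1
        + clawS A x jd * clawS B x j0
        + clawVmin A p₁ q₁ p₂ q₂ x * clawVmax B p₁ q₁ p₂ q₂ x + clawVmax A p₁ q₁ p₂ q₂ x * clawVmin B p₁ q₁ p₂ q₂ x)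
      + ∑ j ∈ univ \ S8, clawS A x j * clawS B x (Fin.rev j)
      ≤ (clawV A p₁ q₁ x * clawV B p₁ q₁ x + clawV A p₂ q₂ x * clawV B p₂ q₂ x)
        + (clawU A x * clawU B x + ∑ i : Fin k, clawW A i x * clawW B i x) := by
    intro x _
    have hr := rearr_clawS A B x
    rw [hsplit (fun j => clawS A x j * clawS B x (Fin.rev j)), r0, r1, r2, r3, re, rf, rc, rd] at hr
    have hv := rearr_two (clawV A p₁ q₁ x) (clawV A p₂ q₂ x) (clawV B p₁ q₁ x) (clawV B p₂ q₂ x)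
    unfold clawVmin clawVmax
    linarith
  -- (2) the inner terms are inner products of unit K-vectors
  have step2 : 0 ≤ ∑ x ∈ P₁, ∑ j ∈ univ \ S8, clawS A x j * clawS B x (Fin.rev j) := by
    rw [sum_comm]
    refine sum_nonneg fun j hj => ?_
    obtain ⟨hj, hjr⟩ := hmid j hj
    exact sum_mul_nonneg_of_unit hP hd hcor (fun x => clawS A x j) (fun x => clawS B x (Fin.rev j))
      (fun x _ => clawS_val A x j) (fun x _ => clawS_val B x (Fin.rev j))
      (fun x _ x' _ h => clawS_mono hA h j) (fun x _ x' _ h => clawS_mono hB h (Fin.rev j))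
      (fun x _ x' _ h => clawS_pair_self hA h j hj) (fun x _ x' _ h => clawS_pair_self hB h (Fin.rev j) hjr)
  -- (3) certificate + acuteness
  have hKK := clawPlusTwo_KK_sum_nonneg_gen hP hd hcor hA hB hpq (j0 := j0) (j1 := j1) (j2 := j2) (j3 := j3) (je := je) (jf := jf)
    (jc := jc) (jd := jd) (by omega) (by omega) (by omega) (by omega) (by omega) (by omega) (by omega)
  have hpt := sum_le_sum fun x (hx : x ∈ P₁) => clawPlusTwo_cert_gen hA hB hpq (j0 := j0) (j1 := j1) (j2 := j2) (j3 := j3) (je := je)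
    (jf := jf) (jc := jc) (jd := jd) (Fin.le_iff_val_le_val.2 (by omega)) (Fin.le_iff_val_le_val.2 (by omega))
    (Fin.le_iff_val_le_val.2 (by omega)) (Fin.le_iff_val_le_val.2 (by omega)) (Fin.le_iff_val_le_val.2 (by omega))
    (Fin.le_iff_val_le_val.2 (by omega)) (Fin.le_iff_val_le_val.2 (by omega)) hje hjc x
  rw [← mul_sum] at hpt
  have hsum := sum_le_sum step1
  simp only [sum_add_distrib] at hsum hpt hKK ⊢
  linarith

end mainthm

/-! ### Corollaries -/

variable {β : Type} [DecidableEq β] [Fintype β]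

/-- **`TriWIneq` for `P₁ ∧ clawPlusTwo p₁ q₁ p₂ q₂`** (`k ≥ 8`) on every index cube, for every intersecting Kleitman shell `P₁`. [this work] -/
theorem triW_nonneg_andProd_clawPlusTwo_of_eight_le (hk : 8 ≤ k) {p₁ q₁ p₂ q₂ : Fin k}
    (hpq : p₁ ≠ q₁ ∧ p₂ ≠ q₂ ∧ p₁ ≠ p₂ ∧ p₁ ≠ q₂ ∧ q₁ ≠ p₂ ∧ q₁ ≠ q₂) {P₁ : Finset (Finset γ₁)}
    (hP : IsUpperSet (P₁ : Set (Finset γ₁))) (hd : Disjoint P₁ (refl P₁))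
    (hcor : ∀ U V : Finset (Finset γ₁), IsUpperSet (U : Set (Finset γ₁)) → IsUpperSet (V : Set (Finset γ₁)) → 0 ≤ corP P₁ U V)
    (F G : Finset β → Finset (Finset (γ₁ ⊕ Fin k)))
    (hF : ∀ x, IsUpperSet (F x : Set (Finset (γ₁ ⊕ Fin k)))) (hG : ∀ x, IsUpperSet (G x : Set (Finset (γ₁ ⊕ Fin k))))
    (hFm : Monotone F) (hGm : Monotone G) :
    0 ≤ triW (andProd P₁ (clawPlusTwo p₁ q₁ p₂ q₂)) F G :=
  triW_nonneg_of_corP_nonneg (isUpperSet_andProd hP (isUpperSet_clawPlusTwo hpq))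
    (fun _ _ hA hB => corP_andProd_clawPlusTwo_nonneg_of_eight_le hP hd hcor hA hB hpq hk) F G hF hG hFm hGm

/-- **The AND-product is again an intersecting Kleitman shell** (`k ≥ 8`). [this work] -/
theorem klShell_andProd_clawPlusTwo_of_eight_le (hk : 8 ≤ k) {p₁ q₁ p₂ q₂ : Fin k}
    (hpq : p₁ ≠ q₁ ∧ p₂ ≠ q₂ ∧ p₁ ≠ p₂ ∧ p₁ ≠ q₂ ∧ q₁ ≠ p₂ ∧ q₁ ≠ q₂) {P₁ : Finset (Finset γ₁)}
    (hP : IsUpperSet (P₁ : Set (Finset γ₁))) (hd : Disjoint P₁ (refl P₁))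
    (hcor : ∀ U V : Finset (Finset γ₁), IsUpperSet (U : Set (Finset γ₁)) → IsUpperSet (V : Set (Finset γ₁)) → 0 ≤ corP P₁ U V) :
    KlShell (andProd P₁ (clawPlusTwo p₁ q₁ p₂ q₂) ∪ refl (andProd P₁ (clawPlusTwo p₁ q₁ p₂ q₂))) :=
  klShell_of_corP_nonneg (disjoint_andProd_refl hd _) fun _ _ hA hB => corP_andProd_clawPlusTwo_nonneg_of_eight_le hP hd hcor hA hB hpq hk

/-- **`AndShellLower` for `Q = clawPlusTwo p₁ q₁ p₂ q₂`** (`k ≥ 8`). [this work] -/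
theorem lForm_le_scoreVal_andProd_clawPlusTwo_of_eight_le (hk : 8 ≤ k) {p₁ q₁ p₂ q₂ : Fin k}
    (hpq : p₁ ≠ q₁ ∧ p₂ ≠ q₂ ∧ p₁ ≠ p₂ ∧ p₁ ≠ q₂ ∧ q₁ ≠ p₂ ∧ q₁ ≠ q₂) {P₁ : Finset (Finset γ₁)}
    (hP : IsUpperSet (P₁ : Set (Finset γ₁))) (hd : Disjoint P₁ (refl P₁)) (hs : KlShell (P₁ ∪ refl P₁))
    {A B : Finset (Finset (γ₁ ⊕ Fin k))} (hA : IsUpperSet (A : Set (Finset (γ₁ ⊕ Fin k)))) (hB : IsUpperSet (B : Set (Finset (γ₁ ⊕ Fin k)))) :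
    lForm (andProd P₁ (clawPlusTwo p₁ q₁ p₂ q₂)) A B ≤ scoreVal (secFAScore P₁ (clawPlusTwo p₁ q₁ p₂ q₂)) A B :=
  lForm_le_scoreVal_secFAScore_of_corP_nonneg (disjoint_clawPlusTwo_refl (by omega) hpq)
    (corP_andProd_clawPlusTwo_nonneg_of_eight_le hP hd
      (fun U V hU hV => by rw [corP_eq_card_sub_card_of_disjoint hd]; exact hs U V hU hV) hA hB hpq hk)

end FiveUpSet

end Summit.CriticalPhenomena.PercolationContinuityZ3.Theorems
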